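import Literature.Computability.Complexity.SharpSATNormalFormMap
import Literature.Computability.Complexity.CanonicalCodes
import HarnessLib

/-!
# Lemma 3 of Liśkiewicz–Ogihara–Toda 2003 on codes: the map is polynomial time, and the
# discharge `LOT2003_lemma3_holds`

Counting complexity, completing `SharpSATNormalForm.lean` (the named fact `LOT2003_lemma3 :
#3SAT ≤ᵖ_pars SHARP3SATNF`) and `SharpSATNormalFormMap.lean` (the map `CNF.lemma3Map` with its
count preservation proved). Source: LOT2003, Lemma 3 ("There is a polynomial time computable
function `f` that maps each 3CNF formula to a 3̄CNF formula such that …"); the running time is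
the only part of Lemma 3 not covered by the sibling files, and it is established here in the
brick-assembly style of `CanonicalCodes.lean` / `FoldBricks.lean` (no machine is written).

## What is here

* `lemma3Fn w = encodingCNF.encode (lemma3Map (decCNF w))` — the reduction on strings (the tree's
  CNF decoder is total, `NegCNF.decode_cnf`), and `SHARP3SATNF_lemma3Fn : SHARP3SATNF (lemma3Fn w)
  = SHARP3SAT w` on EVERY string (3CNF codes by `CNF.numSat_lemma3Map`, the others by
  `CNF.numSat_lemma3Map_of_not_isWidthEq`);
* the brick assembly `Lemma3FP.mapF` computing `lemma3Fn` (`Lemma3FP.mapF_eq_lemma3Fn`): two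
  counted folds (`Brick.foldLoop appF (clipF …)`) over the clause index `j < m` (`m` = length of
  the unary header), one concatenating the unary header pieces `1⁸`/`1²`, the other the framed
  codes of the eight clauses `C̃ⱼ` (`Lemma3FP.pieceF`: the `j`-th raw clause item by
  `HashBricks.nthItemFn`, its three raw literals by the record projections `Brick.nthF`, variables
  re-read canonically by `Brick.canonF` and shifted by `m + 1` with `Brick.addFn`, polarities by
  `HashBricks.headBitFn`, the index numeral `⌜j+1⌝` by `Brick.lenBinF`; a clause item whose header
  does not announce three literals yields the constant code of the contradictory pair);
* `lemma3Fn_mem_FP`, and **`LOT2003_lemma3_holds : LOT2003_lemma3`**.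

## References

* M. Liśkiewicz, M. Ogihara, S. Toda, TCS 304 (2003) 129–156, §2.3, Lemma 3.
* S. Arora, B. Barak, *Computational Complexity: A Modern Approach*, CUP 2009, §1.3 (closure of
  polynomial time under composition and bounded loops), §0.1 (codes of tuples and lists).
-/

namespace Literature.Computability.Complexity

open _root_.Computability Brick HashBricks

/-! ### The reduction on strings and its correctness on every string -/

/-- **Lemma 3 on codes**: `w ↦ code of f(φ_w)` where `φ_w = decCNF w` is the CNF read off `w` by the
tree's total decoder. [cite: LiskiewiczOgiharaToda2003, Lemma 3] -/
def lemma3Fn (w : List Bool) : List Bool :=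
  encodingCNF.encode (CNF.lemma3Map (NegCNF.decCNF w))

/-- `#3SAT` through the total decoder. [cite: LiskiewiczOgiharaToda2003, §2.3 (#3SAT)] -/
theorem SHARP3SAT_eq_decCNF (w : List Bool) :
    SHARP3SAT w = if CNF.IsWidthEq 3 (NegCNF.decCNF w) then (NegCNF.decCNF w).numSat else 0 := by
  simp [SHARP3SAT, cnfCountFn, NegCNF.decode_cnf]

/-- **Correctness of the reduction on every string**: `SHARP3SATNF (lemma3Fn w) = SHARP3SAT w`.
[cite: LiskiewiczOgiharaToda2003, Lemma 3] -/
theorem SHARP3SATNF_lemma3Fn (w : List Bool) : SHARP3SATNF (lemma3Fn w) = SHARP3SAT w := by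
  rw [lemma3Fn, SHARP3SATNF_encode (CNF.isLOTNormalForm_lemma3Map _), SHARP3SAT_eq_decCNF]
  split_ifs with h
  · exact CNF.numSat_lemma3Map h
  · exact CNF.numSat_lemma3Map_of_not_isWidthEq h

/-- Lemma 3 as a reduction follows from the running time alone. [cite: LiskiewiczOgiharaToda2003, Lemma 3] -/
theorem LOT2003_lemma3_of_mem_FP (h : lemma3Fn ∈ FP) : LOT2003_lemma3 :=
  ⟨lemma3Fn, h, fun w => (SHARP3SATNF_lemma3Fn w).symm⟩

namespace Lemma3FP

/-! ### Decoding facts -/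

/-- The items of the total list decoder, by position. [folklore] -/
theorem decList_getElem? {α : Type} (d : List Bool → α) :
    ∀ (n : ℕ) (r : List Bool) (j : ℕ), j < n →
      (NegCNF.decList d n r)[j]? = some (d (fstF (sndF^[j] r)))
  | 0, _, _, h => absurd h (Nat.not_lt_zero _)
  | n + 1, r, 0, _ => by simp [NegCNF.decList, fstF]
  | n + 1, r, j + 1, h => by
    rw [NegCNF.decList, List.getElem?_cons_succ, decList_getElem? d n _ j (by omega)]
    rfl

/-- The number of clauses read off `w` is the length of its unary header. [folklore] -/
theorem length_decCNF (w : List Bool) : (NegCNF.decCNF w).length = (fstF w).length := by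
  simp [NegCNF.decCNF, fstF]

/-- The `j`-th clause read off `w`. [folklore] -/
theorem decCNF_getElem? (w : List Bool) {j : ℕ} (hj : j < (fstF w).length) :
    (NegCNF.decCNF w)[j]? = some (NegCNF.decClause (fstF (sndF^[j] (sndF w)))) :=
  decList_getElem? _ _ _ _ hj

/-- The number of literals of a clause read off an item is the length of its unary header. [folklore] -/
theorem length_decClause (c : List Bool) : (NegCNF.decClause c).length = (fstF c).length := by
  simp [NegCNF.decClause, fstF]

/-- A clause item announcing three literals decodes to the three literals read off its fields
`1, 2, 3`. [folklore] -/
theorem decClause_of_length_eq_three {c : List Bool} (h : (fstF c).length = 3) :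
    NegCNF.decClause c = [NegCNF.decLit (nthF 1 c), NegCNF.decLit (nthF 2 c), NegCNF.decLit (nthF 3 c)] := by
  have : NegCNF.decClause c = NegCNF.decList NegCNF.decLit 3 (sndF c) := by
    rw [NegCNF.decClause, ← h]; rfl
  rw [this]
  rfl

/-- The code of a three-literal clause. [folklore] -/
theorem encodingClause_encode_three (a b c : Literal ℕ) :
    encodingClause.encode [a, b, c] = boolPair [true, true, true]
      (boolPair (encodingLiteral.encode a) (boolPair (encodingLiteral.encode b)
        (boolPair (encodingLiteral.encode c) []))) := by
  simp [encodingClause, Encoding.listBool]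
  rfl

/-- `encodeBool b = [b]`. [folklore] -/
theorem encodeBool_eq (b : Bool) : encodeBool b = [b] := by cases b <;> rfl

/-- The code of a shifted decoded literal, with its polarity kept or flipped. [folklore] -/
theorem encode_shift_decLit (l : List Bool) (K : ℕ) (keep : Bool) :
    encodingLiteral.encode (if keep then (NegCNF.decLit l).shift K else ((NegCNF.decLit l).shift K).negate) =
      boolPair (encodeNat (decodeNat (fstF l) + K))
        [if keep then decodeBool (sndF l) else !decodeBool (sndF l)] := by
  cases keep <;>
    simp [encodingLiteral, Encoding.pairBool, NegCNF.decLit, Literal.shift, Literal.negate,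
      encodingNatBool, encodingBoolBool, encodeBool_eq, fstF, sndF]

/-- The code of the literal `(v, b)`. [folklore] -/
theorem encode_literal (v : ℕ) (b : Bool) :
    encodingLiteral.encode (v, b) = boolPair (encodeNat v) [b] := by
  simp [encodingLiteral, Encoding.pairBool, encodingNatBool, encodingBoolBool, encodeBool_eq]

/-! ### The bricks -/

/-- `⌜m + 1⌝` from the input `w`, `m` the length of its unary header (the shift of the variables).
[cite: LiskiewiczOgiharaToda2003, §2.3 (proof of Lemma 3)] -/
noncomputable def shiftNumF : List Bool → List Bool :=
  addFn ∘ fanoutFn (lenBinF ∘ fstF) (fun _ => [true])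

/-- Value of `shiftNumF`. [folklore] -/
theorem shiftNumF_apply (w : List Bool) : shiftNumF w = encodeNat ((fstF w).length + 1) := by
  simp [shiftNumF]

/-- `shiftNumF ∈ FP`. [folklore] -/
theorem shiftNumF_mem_FP : shiftNumF ∈ FP :=
  comp_mem_FP addFn_mem_FP (fanoutFn_mem_FP (comp_mem_FP lenBinF_mem_FP fstF_mem_FP) (const_mem_FP _))

/-- On the piece context `⟨w, 1ʲ⟩`: the raw `j`-th clause item of `w`. [folklore] -/
noncomputable def itemF : List Bool → List Bool :=
  nthItemFn ∘ fanoutFn sndF (sndF ∘ fstF)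

/-- Value of `itemF`. [folklore] -/
theorem itemF_apply (w u : List Bool) : itemF (boolPair w u) = fstF (sndF^[u.length] (sndF w)) := by
  simp [itemF, nthItemFn_boolPair]

/-- `itemF ∈ FP`. [folklore] -/
theorem itemF_mem_FP : itemF ∈ FP :=
  comp_mem_FP nthItemFn_mem_FP (fanoutFn_mem_FP sndF_mem_FP (comp_mem_FP sndF_mem_FP fstF_mem_FP))

/-- On the piece context `⟨w, 1ʲ⟩`: the numeral `⌜j + 1⌝` (the variable `uⱼ`). [folklore] -/
noncomputable def idxNumF : List Bool → List Bool :=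
  addFn ∘ fanoutFn (lenBinF ∘ sndF) (fun _ => [true])

/-- Value of `idxNumF`. [folklore] -/
theorem idxNumF_apply (w u : List Bool) : idxNumF (boolPair w u) = encodeNat (u.length + 1) := by
  simp [idxNumF]

/-- `idxNumF ∈ FP`. [folklore] -/
theorem idxNumF_mem_FP : idxNumF ∈ FP :=
  comp_mem_FP addFn_mem_FP (fanoutFn_mem_FP (comp_mem_FP lenBinF_mem_FP sndF_mem_FP) (const_mem_FP _))

/-- On the piece context: the raw literal `t` (field `t + 1`) of the clause item. [folklore] -/
noncomputable def rawLitF (t : ℕ) : List Bool → List Bool :=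
  nthF (t + 1) ∘ itemF

/-- `rawLitF t ∈ FP`. [folklore] -/
theorem rawLitF_mem_FP (t : ℕ) : rawLitF t ∈ FP :=
  comp_mem_FP (nthF_mem_FP _) itemF_mem_FP

/-- The polarity bit of raw literal `t`, kept. [folklore] -/
noncomputable def polKeepF (t : ℕ) : List Bool → List Bool :=
  headBitFn ∘ sndF ∘ rawLitF t

/-- The polarity bit of raw literal `t`, flipped. [folklore] -/
noncomputable def polFlipF (t : ℕ) : List Bool → List Bool :=
  notFn (polKeepF t)

/-- Value of `polKeepF`. [folklore] -/
theorem polKeepF_apply (t : ℕ) (z : List Bool) :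
    polKeepF t z = [decodeBool (sndF (rawLitF t z))] := by
  simp only [polKeepF, Function.comp_apply, CanonCode.headBitFn_eq_encodeBool_decodeBool,
    encodeBool_eq]

/-- Value of `polFlipF`. [folklore] -/
theorem polFlipF_apply (t : ℕ) (z : List Bool) :
    polFlipF t z = [!decodeBool (sndF (rawLitF t z))] := by
  rw [polFlipF, notFn_apply (polKeepF_apply t z)]

/-- `polKeepF t ∈ FP`. [folklore] -/
theorem polKeepF_mem_FP (t : ℕ) : polKeepF t ∈ FP :=
  comp_mem_FP headBitFn_mem_FP (comp_mem_FP sndF_mem_FP (rawLitF_mem_FP t))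

/-- `polFlipF t ∈ FP`. [folklore] -/
theorem polFlipF_mem_FP (t : ℕ) : polFlipF t ∈ FP :=
  notFn_mem_FP (polKeepF_mem_FP t)

/-- On the piece context: the code of raw literal `t` with its variable shifted by `m + 1` and the
polarity bit computed by `pol` (`polKeepF t` or `polFlipF t`).
[cite: LiskiewiczOgiharaToda2003, §2.3 (proof of Lemma 3)] -/
noncomputable def litF (t : ℕ) (pol : List Bool → List Bool) : List Bool → List Bool :=
  fanoutFn (addFn ∘ fanoutFn (canonF ∘ fstF ∘ rawLitF t) (shiftNumF ∘ fstF)) pol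

/-- Value of `litF` on a context `⟨w, u⟩`. [folklore] -/
theorem litF_apply (t : ℕ) (pol : List Bool → List Bool) (w u : List Bool) :
    litF t pol (boolPair w u) =
      boolPair (encodeNat (decodeNat (fstF (rawLitF t (boolPair w u))) + ((fstF w).length + 1)))
        (pol (boolPair w u)) := by
  simp [litF, shiftNumF_apply, bitsToNat_canonF]

/-- `litF t pol ∈ FP` for `pol ∈ FP`. [folklore] -/
theorem litF_mem_FP (t : ℕ) {pol : List Bool → List Bool} (hpol : pol ∈ FP) : litF t pol ∈ FP :=
  fanoutFn_mem_FP (comp_mem_FP addFn_mem_FP (fanoutFn_mem_FP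
    (comp_mem_FP canonF_mem_FP (comp_mem_FP fstF_mem_FP (rawLitF_mem_FP t)))
    (comp_mem_FP shiftNumF_mem_FP fstF_mem_FP))) hpol

/-- The code of raw literal `t`, shifted, polarity kept. [cite: LiskiewiczOgiharaToda2003, §2.3 (proof of Lemma 3)] -/
noncomputable def litPosF (t : ℕ) : List Bool → List Bool :=
  litF t (polKeepF t)

/-- The code of raw literal `t`, shifted, polarity flipped (the negated literal).
[cite: LiskiewiczOgiharaToda2003, §2.3 (proof of Lemma 3)] -/
noncomputable def litNegF (t : ℕ) : List Bool → List Bool :=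
  litF t (polFlipF t)

/-- `litPosF t ∈ FP`. [folklore] -/
theorem litPosF_mem_FP (t : ℕ) : litPosF t ∈ FP :=
  litF_mem_FP t (polKeepF_mem_FP t)

/-- `litNegF t ∈ FP`. [folklore] -/
theorem litNegF_mem_FP (t : ℕ) : litNegF t ∈ FP :=
  litF_mem_FP t (polFlipF_mem_FP t)

/-- On the piece context: the code of the literal `(uⱼ, b)`. [cite: LiskiewiczOgiharaToda2003, §2.3 (proof of Lemma 3)] -/
noncomputable def uCodeF (b : Bool) : List Bool → List Bool :=
  fanoutFn idxNumF (fun _ => [b])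

/-- Value of `uCodeF`. [folklore] -/
theorem uCodeF_apply (b : Bool) (w u : List Bool) :
    uCodeF b (boolPair w u) = boolPair (encodeNat (u.length + 1)) [b] := by
  simp [uCodeF, idxNumF_apply]

/-- `uCodeF b ∈ FP`. [folklore] -/
theorem uCodeF_mem_FP (b : Bool) : uCodeF b ∈ FP :=
  fanoutFn_mem_FP idxNumF_mem_FP (const_mem_FP _)

/-- The code of the literal `(w, b) = (x₀, b)` (a constant). [cite: LiskiewiczOgiharaToda2003, §2.3 (proof of Lemma 3)] -/
def wCode (b : Bool) : List Bool :=
  boolPair [] [b]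

/-- The code of a three-literal clause from the codes of its literals. [folklore] -/
noncomputable def clauseF (a b c : List Bool → List Bool) : List Bool → List Bool :=
  fanoutFn (fun _ => [true, true, true]) (fanoutFn a (fanoutFn b (fanoutFn c (fun _ => []))))

/-- Value of `clauseF`. [folklore] -/
theorem clauseF_apply (a b c : List Bool → List Bool) (z : List Bool) :
    clauseF a b c z = boolPair [true, true, true] (boolPair (a z) (boolPair (b z) (boolPair (c z) []))) := by
  simp [clauseF]

/-- `clauseF a b c ∈ FP`. [folklore] -/
theorem clauseF_mem_FP {a b c : List Bool → List Bool} (ha : a ∈ FP) (hb : b ∈ FP) (hc : c ∈ FP) :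
    clauseF a b c ∈ FP :=
  fanoutFn_mem_FP (const_mem_FP _) (fanoutFn_mem_FP ha (fanoutFn_mem_FP hb (fanoutFn_mem_FP hc (const_mem_FP _))))

/-- **The framed codes of the eight clauses `C̃ⱼ`** on the piece context (in the order of
`CNF.lemma3Block`: `D₁, D̄₁, D₂, D̄₂, D₃, D̄₃, D₄, D̄₄`). [cite: LiskiewiczOgiharaToda2003, §2.3 (proof of Lemma 3, C̃ᵢ)] -/
noncomputable def blockF : List Bool → List Bool :=
  fanoutFn (clauseF (litPosF 0) (litPosF 1) (uCodeF false))
    (fanoutFn (clauseF (litNegF 0) (litNegF 1) (uCodeF true))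
      (fanoutFn (clauseF (litNegF 0) (uCodeF true) (fun _ => wCode true))
        (fanoutFn (clauseF (litPosF 0) (uCodeF false) (fun _ => wCode false))
          (fanoutFn (clauseF (litNegF 1) (uCodeF true) (fun _ => wCode true))
            (fanoutFn (clauseF (litPosF 1) (uCodeF false) (fun _ => wCode false))
              (fanoutFn (clauseF (uCodeF true) (litPosF 2) (fun _ => wCode true))
                (fanoutFn (clauseF (uCodeF false) (litNegF 2) (fun _ => wCode false))
                  (fun _ => []))))))))

/-- `blockF ∈ FP`. [folklore] -/
theorem blockF_mem_FP : blockF ∈ FP :=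
  fanoutFn_mem_FP (clauseF_mem_FP (litPosF_mem_FP 0) (litPosF_mem_FP 1) (uCodeF_mem_FP false))
    (fanoutFn_mem_FP (clauseF_mem_FP (litNegF_mem_FP 0) (litNegF_mem_FP 1) (uCodeF_mem_FP true))
      (fanoutFn_mem_FP (clauseF_mem_FP (litNegF_mem_FP 0) (uCodeF_mem_FP true) (const_mem_FP _))
        (fanoutFn_mem_FP (clauseF_mem_FP (litPosF_mem_FP 0) (uCodeF_mem_FP false) (const_mem_FP _))
          (fanoutFn_mem_FP (clauseF_mem_FP (litNegF_mem_FP 1) (uCodeF_mem_FP true) (const_mem_FP _))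
            (fanoutFn_mem_FP (clauseF_mem_FP (litPosF_mem_FP 1) (uCodeF_mem_FP false) (const_mem_FP _))
              (fanoutFn_mem_FP (clauseF_mem_FP (uCodeF_mem_FP true) (litPosF_mem_FP 2) (const_mem_FP _))
                (fanoutFn_mem_FP (clauseF_mem_FP (uCodeF_mem_FP false) (litNegF_mem_FP 2) (const_mem_FP _))
                  (const_mem_FP _))))))))

/-- The framed codes of the contradictory pair `(w ∨ w ∨ w), (¬w ∨ ¬w ∨ ¬w)` (a constant).
[folklore] -/
def fallbackPiece : List Bool :=
  frames ([[((0 : ℕ), true), (0, true), (0, true)],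
    Clause.complement [((0 : ℕ), true), (0, true), (0, true)]].map encodingClause.encode)

/-- The test "the clause item announces three literals", one bit. [folklore] -/
noncomputable def is3F : List Bool → List Bool :=
  eqPairFn ∘ fanoutFn (onesFn ∘ fstF ∘ itemF) (fun _ => [true, true, true])

/-- Value of `is3F`. [folklore] -/
theorem is3F_apply (z : List Bool) : is3F z = [decide ((fstF (itemF z)).length = 3)] := by
  simp only [is3F, Function.comp_apply, fanoutFn_apply, eqPairFn_boolPair, onesFn,
    OracleCompose.unaryEncodeNat_eq_replicate]
  congr 1
  exact decide_eq_decide.mpr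
    ⟨fun h => by simpa using congrArg List.length h, fun h => by rw [h]; rfl⟩

/-- `is3F ∈ FP`. [folklore] -/
theorem is3F_mem_FP : is3F ∈ FP :=
  comp_mem_FP eqPairFn_mem_FP (fanoutFn_mem_FP
    (comp_mem_FP onesFn_mem_FP (comp_mem_FP fstF_mem_FP itemF_mem_FP)) (const_mem_FP _))

/-- **The piece of round `j`**: the framed codes of `C̃ⱼ`, or of the contradictory pair when the
item does not announce three literals. [cite: LiskiewiczOgiharaToda2003, §2.3 (proof of Lemma 3)] -/
noncomputable def pieceF : List Bool → List Bool :=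
  iteFn is3F blockF (fun _ => fallbackPiece)

/-- `pieceF ∈ FP`. [folklore] -/
theorem pieceF_mem_FP : pieceF ∈ FP :=
  iteFn_mem_FP is3F_mem_FP blockF_mem_FP (const_mem_FP _)

/-- **The header piece of round `j`**: `1⁸` or `1²`, the number of clauses contributed. [folklore] -/
noncomputable def hdrPieceF : List Bool → List Bool :=
  iteFn is3F (fun _ => ones 8) (fun _ => ones 2)

/-- `hdrPieceF ∈ FP`. [folklore] -/
theorem hdrPieceF_mem_FP : hdrPieceF ∈ FP :=
  iteFn_mem_FP is3F_mem_FP (const_mem_FP _) (const_mem_FP _)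

/-- The initial record `⟨w, ⟨⌜m⌝, ⟨1⁰, ε⟩⟩⟩` of the folds. [folklore] -/
noncomputable def initF : List Bool → List Bool :=
  fanoutFn id (fanoutFn (lenBinF ∘ fstF) (fun _ => boolPair [] []))

/-- Value of `initF`. [folklore] -/
theorem initF_apply (w : List Bool) :
    initF w = boolPair w (boolPair (encodeNat (fstF w).length) (boolPair (ones 0) [])) := by
  simp [initF]

/-- `initF ∈ FP`. [folklore] -/
theorem initF_mem_FP : initF ∈ FP :=
  fanoutFn_mem_FP OracleCompose.id_mem_FP
    (fanoutFn_mem_FP (comp_mem_FP lenBinF_mem_FP fstF_mem_FP) (const_mem_FP _))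

open Polynomial in
/-- **The fold of a piece function over the clause index**: `|w|` rounds available, `m ≤ |w|`
used; the result is the concatenation of the pieces (`runF_apply`). [cite: AroraBarak2009, §1.3 (bounded loops)] -/
noncomputable def runF (C : ℕ) (f : List Bool → List Bool) : List Bool → List Bool :=
  sndPow 2 ∘ foldLoop appF (clipF C f) X ∘ initF

/-- `runF C f ∈ FP` for `f ∈ FP`. [folklore] -/
theorem runF_mem_FP (C : ℕ) {f : List Bool → List Bool} (hf : f ∈ FP) : runF C f ∈ FP :=
  comp_mem_FP (sndPow_mem_FP 2)
    (comp_mem_FP (foldLoop_clipF_mem_FP C appF_mem_FP length_appF_le hf _) initF_mem_FP)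

/-- **Value of the fold**: the concatenation of the pieces `f ⟨w, 1ʲ⟩`, `j < m`, provided these are
within the clipping bound. [folklore] -/
theorem runF_apply {C : ℕ} {f : List Bool → List Bool} {w : List Bool}
    (hC : ∀ j, j < (fstF w).length → (f (boolPair w (ones j))).length ≤ C * (w.length + 1)) :
    runF C f w = ccat (fun j => f (boolPair w (ones j))) (fstF w).length := by
  have hm : (fstF w).length ≤ (Polynomial.X : Polynomial ℕ).eval w.length := by
    rw [Polynomial.eval_X]
    have := length_fstF_sndF_le w
    omega
  rw [runF, Function.comp_apply, Function.comp_apply, initF_apply, foldLoop_apply _ _ hm,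
    foldAcc_clipF (fun j _ hj => hC j (by omega)), foldAcc_appF]
  simp [sndPow]

/-- **The brick assembly computing Lemma 3's map on codes**: header `1 · (header pieces)`, then
the code of the unit clause `(¬w)` paired with the concatenated clause pieces.
[cite: LiskiewiczOgiharaToda2003, Lemma 3] -/
noncomputable def mapF : List Bool → List Bool :=
  fanoutFn (List.cons true ∘ runF 8 hdrPieceF)
    (fanoutFn (fun _ => encodingClause.encode [((0 : ℕ), false)]) (runF 1500 pieceF))

/-- `mapF ∈ FP`. [cite: LiskiewiczOgiharaToda2003, Lemma 3 ("polynomial time computable")] -/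
theorem mapF_mem_FP : mapF ∈ FP :=
  fanoutFn_mem_FP (comp_mem_FP (cons_mem_FP true) (runF_mem_FP 8 hdrPieceF_mem_FP))
    (fanoutFn_mem_FP (const_mem_FP _) (runF_mem_FP 1500 pieceF_mem_FP))

/-! ### Values of the pieces -/

/-- A shifted decoded literal, as a pair. [folklore] -/
theorem decLit_shift (l : List Bool) (K : ℕ) :
    (NegCNF.decLit l).shift K = (decodeNat (fstF l) + K, decodeBool (sndF l)) := rfl

/-- `encodeNat 0 = ε` (private copy of `TokConv.encodeNat_zero'` of `TokenStreams.lean`, not in the import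
closure). [folklore] -/
private theorem encodeNat_zero : encodeNat 0 = [] := rfl

/-- **`blockF` computes the framed codes of `C̃ⱼ`** for the clause whose raw literals are the
fields `1, 2, 3` of the raw item (`m = |fstF w|`, `j = |u|`).
[cite: LiskiewiczOgiharaToda2003, §2.3 (proof of Lemma 3, C̃ᵢ)] -/
theorem blockF_eq (w u : List Bool) :
    blockF (boolPair w u) = frames ((CNF.lemma3Block (fstF w).length u.length
      [NegCNF.decLit (rawLitF 0 (boolPair w u)), NegCNF.decLit (rawLitF 1 (boolPair w u)),
        NegCNF.decLit (rawLitF 2 (boolPair w u))]).map encodingClause.encode) := by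
  simp only [blockF, fanoutFn_apply, clauseF_apply, litPosF, litNegF, litF_apply, polKeepF_apply,
    polFlipF_apply, uCodeF_apply, wCode]
  simp only [CNF.lemma3Block, List.map_cons, List.map_nil, Clause.complement, frames_cons_eq_boolPair,
    frames_nil, encodingClause_encode_three, decLit_shift, Literal.negate, encode_literal,
    Bool.not_not, Bool.not_true, Bool.not_false, encodeNat_zero]

/-- The header piece is `1⁸` or `1²` according to the announced width of the item. [folklore] -/
theorem hdrPieceF_apply (z : List Bool) :
    hdrPieceF z = if (fstF (itemF z)).length = 3 then ones 8 else ones 2 := by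
  rw [hdrPieceF, iteFn_apply (is3F_apply z)]
  by_cases h : (fstF (itemF z)).length = 3 <;> simp [h]

/-- The piece is `blockF` when the item announces three literals. [folklore] -/
theorem pieceF_apply_of_eq {z : List Bool} (h : (fstF (itemF z)).length = 3) : pieceF z = blockF z := by
  rw [pieceF, iteFn_apply (is3F_apply z)]
  simp [h]

/-- The piece is the contradictory pair otherwise. [folklore] -/
theorem pieceF_apply_of_ne {z : List Bool} (h : (fstF (itemF z)).length ≠ 3) :
    pieceF z = fallbackPiece := by
  rw [pieceF, iteFn_apply (is3F_apply z)]
  simp [h]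

/-- The number of clauses of `C̃ⱼ` by the width of `Cⱼ`. [folklore] -/
theorem length_lemma3Block_eq (m j : ℕ) (C : Clause ℕ) :
    (CNF.lemma3Block m j C).length = if C.length = 3 then 8 else 2 := by
  split_ifs with h
  · exact CNF.length_lemma3Block h m j
  · rw [CNF.lemma3Block_of_length_ne h]
    rfl

/-- The `j`-th clause of `decCNF w`, with default, is the clause read off the `j`-th raw item. [folklore] -/
theorem getD_decCNF (w : List Bool) {j : ℕ} (hj : j < (fstF w).length) :
    (NegCNF.decCNF w)[j]?.getD [] = NegCNF.decClause (itemF (boolPair w (ones j))) := by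
  rw [decCNF_getElem? w hj, itemF_apply, List.length_replicate]
  rfl

/-- **The header piece of round `j < m`** is `1^{|C̃ⱼ|}`. [folklore] -/
theorem hdrPieceF_eq (w : List Bool) {j : ℕ} (hj : j < (fstF w).length) :
    hdrPieceF (boolPair w (ones j)) =
      ones (CNF.lemma3Block (fstF w).length j ((NegCNF.decCNF w)[j]?.getD [])).length := by
  rw [hdrPieceF_apply, length_lemma3Block_eq, getD_decCNF w hj, length_decClause]
  split_ifs <;> rfl

/-- **The piece of round `j < m`** is the framed code list of `C̃ⱼ`.
[cite: LiskiewiczOgiharaToda2003, §2.3 (proof of Lemma 3)] -/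
theorem pieceF_eq (w : List Bool) {j : ℕ} (hj : j < (fstF w).length) :
    pieceF (boolPair w (ones j)) =
      frames ((CNF.lemma3Block (fstF w).length j ((NegCNF.decCNF w)[j]?.getD [])).map
        encodingClause.encode) := by
  rw [getD_decCNF w hj]
  by_cases h : (fstF (itemF (boolPair w (ones j)))).length = 3
  · rw [pieceF_apply_of_eq h, blockF_eq, decClause_of_length_eq_three h, List.length_replicate]
    rfl
  · rw [pieceF_apply_of_ne h, CNF.lemma3Block_of_length_ne (by rwa [length_decClause])]
    rfl

/-! ### Concatenating the pieces -/

/-- A back-peeled concatenation of values at the items of a list is the flattened indexed map.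
[folklore] -/
theorem ccat_eq_flatten_map_mapIdx {α γ : Type} (H : ℕ → α → γ) (G : γ → List Bool) (d : α) :
    ∀ l : List α, ccat (fun j => G (H j (l[j]?.getD d))) l.length = ((l.mapIdx H).map G).flatten := by
  intro l
  induction l using List.reverseRecOn with
  | nil => rfl
  | append_singleton l a ih =>
    rw [List.length_append, List.length_singleton, ccat_succ, List.mapIdx_append, List.map_append,
      List.flatten_append]
    congr 1
    · rw [← ih]
      exact ccat_congr fun i hi => by rw [List.getElem?_append_left hi]
    · simp

/-- `frames` of a flattened list. [folklore] -/
theorem frames_flatten : ∀ L : List (List (List Bool)), frames L.flatten = (L.map frames).flatten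
  | [] => rfl
  | l :: L => by rw [List.flatten_cons, frames_append, frames_flatten L, List.map_cons, List.flatten_cons]

/-- Concatenated blocks of ones. [folklore] -/
theorem flatten_map_ones_length {α : Type} : ∀ L : List (List α),
    (L.map fun l => ones l.length).flatten = ones L.flatten.length
  | [] => rfl
  | l :: L => by
    rw [List.map_cons, List.flatten_cons, flatten_map_ones_length L, List.flatten_cons,
      List.length_append]
    exact (List.replicate_add _ _ _).symm

/-! ### Size of the pieces (for unclipping) -/

/-- `|fstF x| ≤ |x|`. [folklore] -/
theorem length_fstF_le (x : List Bool) : (fstF x).length ≤ x.length := by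
  have := length_fstF_sndF_le x; omega

/-- `|sndF x| ≤ |x|`. [folklore] -/
theorem length_sndF_le (x : List Bool) : (sndF x).length ≤ x.length := by
  have := length_fstF_sndF_le x; omega

/-- `|sndFʲ x| ≤ |x|`. [folklore] -/
theorem length_iterate_sndF_le : ∀ (j : ℕ) (x : List Bool), (sndF^[j] x).length ≤ x.length
  | 0, _ => le_rfl
  | j + 1, x => (length_iterate_sndF_le j (sndF x)).trans (length_sndF_le x)

/-- The raw literals are substrings' worth: `|rawLitF t ⟨w, u⟩| ≤ |w|`. [folklore] -/
theorem length_rawLitF_le (t : ℕ) (w u : List Bool) : (rawLitF t (boolPair w u)).length ≤ w.length := by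
  rw [rawLitF, Function.comp_apply, itemF_apply]
  exact (length_nthF_le _ _).trans ((length_fstF_le _).trans
    ((length_iterate_sndF_le _ _).trans (length_sndF_le w)))

/-- The size of a shifted numeral. [folklore] -/
theorem length_encodeNat_decodeNat_add_le (a : List Bool) (K : ℕ) :
    (encodeNat (decodeNat a + K)).length ≤ a.length + (encodeNat K).length + 2 := by
  have h := length_encodeNat_add_le (canonF a) (encodeNat K)
  rw [bitsToNat_canonF, bitsToNat_encodeNat] at h
  have := length_canonF_le a
  omega

/-- Size of a shifted literal code: `≤ 4|w| + 11`. [folklore] -/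
theorem length_litF_le (t : ℕ) {pol : List Bool → List Bool} (hpol : ∀ z, (pol z).length = 1)
    (w u : List Bool) : (litF t pol (boolPair w u)).length ≤ 4 * w.length + 11 := by
  rw [litF_apply, length_boolPair, hpol]
  have h1 := length_encodeNat_decodeNat_add_le (fstF (rawLitF t (boolPair w u))) ((fstF w).length + 1)
  have h2 := (length_fstF_le _).trans (length_rawLitF_le t w u)
  have h3 := TM2Pass.length_encodeNat_le_self ((fstF w).length + 1)
  have h4 := length_fstF_le w
  omega

/-- Size of `litPosF`. [folklore] -/
theorem length_litPosF_le (t : ℕ) (w u : List Bool) : (litPosF t (boolPair w u)).length ≤ 4 * w.length + 11 :=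
  length_litF_le t (fun z => by rw [polKeepF_apply]; rfl) w u

/-- Size of `litNegF`. [folklore] -/
theorem length_litNegF_le (t : ℕ) (w u : List Bool) : (litNegF t (boolPair w u)).length ≤ 4 * w.length + 11 :=
  length_litF_le t (fun z => by rw [polFlipF_apply]; rfl) w u

/-- Size of a `u`-literal code: `≤ 2|u| + 7`. [folklore] -/
theorem length_uCodeF_le (b : Bool) (w u : List Bool) : (uCodeF b (boolPair w u)).length ≤ 2 * u.length + 7 := by
  rw [uCodeF_apply, length_boolPair]
  have := TM2Pass.length_encodeNat_le_self (u.length + 1)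
  simp only [List.length_singleton]
  omega

/-- Size of a clause code. [folklore] -/
theorem length_clauseF (a b c : List Bool → List Bool) (z : List Bool) :
    (clauseF a b c z).length = 2 * ((a z).length + (b z).length + (c z).length) + 14 := by
  rw [clauseF_apply]
  simp only [length_boolPair, List.length_cons, List.length_nil]
  omega

/-- **Size of the block piece**: `≤ 384|w| + 1296` when `|u| ≤ |w|`. [folklore] -/
theorem length_blockF_le (w u : List Bool) (hu : u.length ≤ w.length) :
    (blockF (boolPair w u)).length ≤ 384 * w.length + 1296 := by
  have hp0 := length_litPosF_le 0 w u
  have hp1 := length_litPosF_le 1 w u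
  have hp2 := length_litPosF_le 2 w u
  have hn0 := length_litNegF_le 0 w u
  have hn1 := length_litNegF_le 1 w u
  have hn2 := length_litNegF_le 2 w u
  have hut := length_uCodeF_le true w u
  have huf := length_uCodeF_le false w u
  have hw : ∀ b, (wCode b).length = 3 := fun b => by simp [wCode]
  rw [blockF]
  simp only [fanoutFn_apply, length_boolPair, length_clauseF, List.length_nil, hw]
  omega

/-- Size of the contradictory pair's code. [folklore] -/
theorem length_fallbackPiece : fallbackPiece.length = 132 := by
  simp [fallbackPiece, Clause.complement, Literal.negate, encodingClause_encode_three, encode_literal,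
    encodeNat_zero]

/-- **The pieces folded are within the clipping bound** `1500 (|w| + 1)`. [folklore] -/
theorem length_pieceF_le (w : List Bool) {j : ℕ} (hj : j < (fstF w).length) :
    (pieceF (boolPair w (ones j))).length ≤ 1500 * (w.length + 1) := by
  by_cases h : (fstF (itemF (boolPair w (ones j)))).length = 3
  · rw [pieceF_apply_of_eq h]
    have hu : (ones j).length ≤ w.length := by
      rw [List.length_replicate]; exact (hj.trans_le (length_fstF_le w)).le
    have := length_blockF_le w (ones j) hu
    omega
  · rw [pieceF_apply_of_ne h, length_fallbackPiece]
    omega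

/-- The header pieces are within the clipping bound `8 (|w| + 1)`. [folklore] -/
theorem length_hdrPieceF_le (z : List Bool) : (hdrPieceF z).length ≤ 8 := by
  rw [hdrPieceF_apply]
  split_ifs <;> simp

/-! ### The assembly computes Lemma 3's map -/

/-- The header fold yields `1^{L}`, `L` the number of three-literal clauses of `f(φ_w)`. [folklore] -/
theorem runF_hdrPieceF (w : List Bool) :
    runF 8 hdrPieceF w =
      ones ((NegCNF.decCNF w).mapIdx (CNF.lemma3Block (fstF w).length)).flatten.length := by
  have key := ccat_eq_flatten_map_mapIdx (CNF.lemma3Block (fstF w).length) (fun B => ones B.length)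
    [] (NegCNF.decCNF w)
  rw [length_decCNF] at key
  rw [runF_apply (fun j _ => (length_hdrPieceF_le _).trans (by omega)),
    ccat_congr (fun j hj => hdrPieceF_eq w hj), key, flatten_map_ones_length]

/-- The piece fold yields the framed codes of the three-literal clauses of `f(φ_w)`. [folklore] -/
theorem runF_pieceF (w : List Bool) :
    runF 1500 pieceF w =
      frames ((((NegCNF.decCNF w).mapIdx (CNF.lemma3Block (fstF w).length)).flatten).map
        encodingClause.encode) := by
  have key := ccat_eq_flatten_map_mapIdx (CNF.lemma3Block (fstF w).length)
    (fun B => frames (B.map encodingClause.encode)) [] (NegCNF.decCNF w)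
  rw [length_decCNF] at key
  rw [runF_apply (fun j hj => length_pieceF_le w hj), ccat_congr (fun j hj => pieceF_eq w hj), key,
    List.map_flatten, frames_flatten, List.map_map]
  rfl

/-- **The brick assembly computes Lemma 3's map on codes.** [cite: LiskiewiczOgiharaToda2003, Lemma 3] -/
theorem mapF_eq_lemma3Fn : mapF = lemma3Fn := by
  funext w
  rw [lemma3Fn, CNF.lemma3Map, length_decCNF w]
  change _ = boolPair (unaryEncodeNat _) (List.foldr _ [] _)
  rw [foldr_boolPair_eq, List.map_cons, frames_cons_eq_boolPair, List.length_cons,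
    OracleCompose.unaryEncodeNat_eq_replicate, List.replicate_succ, mapF, fanoutFn_apply,
    fanoutFn_apply, Function.comp_apply, runF_hdrPieceF, runF_pieceF]

end Lemma3FP

/-- **Lemma 3's map on codes is polynomial time.** [cite: LiskiewiczOgiharaToda2003, Lemma 3 ("polynomial time computable function f")] -/
theorem lemma3Fn_mem_FP : lemma3Fn ∈ FP :=
  Lemma3FP.mapF_eq_lemma3Fn ▸ Lemma3FP.mapF_mem_FP

/-- **Lemma 3 of LOT2003, discharged**: `#3SAT ≤ᵖ_pars SHARP3SATNF`.
[cite: LiskiewiczOgiharaToda2003, Lemma 3] -/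
theorem LOT2003_lemma3_holds : LOT2003_lemma3 :=
  LOT2003_lemma3_of_mem_FP lemma3Fn_mem_FP

end Literature.Computability.Complexity
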